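import Summits.Ventures.QEDPrecision.Integrands.KallenSabryPhiIntegrable

/-!
# (R-IBP), part 3/3: `∫₀¹ ρ₄(t)/W_t(x) dt = ∫₀¹ Φ(t,x) dt` — the Källén–Sabry insertion integral as the
integral of an elementary function; Sets I(b), I(c) as iterated integrals of `Φ`
(venture QEDPrecision, cell `pub-qed`, integrator seat quad, gen 10)

HONEST FRAMING (verbatim, venture QEDPrecision): independent recomputation; certified where stated,
statistical where stated; no new-physics claim.

WHAT IS KERNEL-CHECKED HERE: the representation identity of the cell memo `certs/SetIbIc/repr/R-IBP.md`,
`integral_rho4_div_wt_eq_integral_phiIBP : 0 < x < 1 → ∫₀¹ ρ₄(t)/W_t(x) dt = ∫₀¹ Φ(t,x) dt`, with `Φ`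
(`phiIBP`, part 1) EXACTLY the printed dilogarithm-free integrand that the certificate's instrument B1′
integrates; and the corollaries `setIcRep_eq_integral_phiIBP`, `setIbRep_eq_integral_phiIBP`: the typed
Sets I(c), I(b) (Literature `setIcRep`, `setIbRep`, Jegerlehner (3.159)–(3.161)) ARE the iterated
integrals of `Φ`. Proof: `G = P·D` is a primitive of `ρ₄/W − Φ = qD − PS` on `(0,1)` (part 1:
`∂ₜP = q`, `∂ₜD = −S`), continuous on `[0,1]`, with `G(0) = 0` (`P(0,x) = 0`) and `G(1) = 0` (the bracket
`ζ(2) + 2Li₂(0) + 2Li₂(1) − 2Li₂(0) − 4Li₂(1) + Li₂(1)` vanishes — the memo's "no ζ(2) and no boundary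
term survive"); integrability from part 2. NO numerical value is asserted; the premises of the
certificate's quadrature remainder bounds (`gl_bounds.md`, `de_bounds.md`) are NOT formalised here —
the label this file changes is only "representation identity (R-IBP): NOT Lean-proved" → "kernel-checked".
-/

noncomputable section

open Real Set MeasureTheory intervalIntegral

namespace Summit.Ventures.QEDPrecision.Integrands

open Literature.MathematicalPhysics.QuantumFieldTheory.Jegerlehner2017 (rho4 wt seqInsertion setIbRep
  setIcRep setIbRep_eq)
open Literature.Analysis.SpecialFunctions (reDilog reDilog_one reDilog_zero)

/-! ## The representation identity -/

/-- **(R-IBP), kernel-checked.** For `0 < x < 1`,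
`∫₀¹ ρ₄(t)/W_t(x) dt = ∫₀¹ Φ(t,x) dt` with `Φ` the dilogarithm-free integrand `phiIBP` printed in
`certs/SetIbIc/repr/R-IBP.md` — the function the cell's instrument B1′ integrates for Sets I(b), I(c).
Proof: `G = P·D` is a primitive of `ρ₄/W − Φ` on `(0,1)`, continuous on `[0,1]`, `G(0) = G(1) = 0`.
[cell result: quad gen 10; representation of certs/SetIbIc/repr/R-IBP.md] -/
theorem integral_rho4_div_wt_eq_integral_phiIBP {x : ℝ} (hx0 : 0 < x) (hx1 : x < 1) :
    ∫ t in (0:ℝ)..1, rho4 t / wt t x 1 = ∫ t in (0:ℝ)..1, phiIBP x t := by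
  -- the difference `g = ρ₄/W − Φ = qD − PS` off `t = 1`
  have hΦ := intervalIntegrable_phiIBP hx0 hx1
  have hg : IntervalIntegrable (fun t : ℝ => ksQ x t * ksD t - ksPrim x t * ksS t) volume 0 1 := by
    refine IntervalIntegrable.sub ?_ (intervalIntegrable_ksS.continuousOn_mul ?_)
    · refine ContinuousOn.intervalIntegrable ?_
      rw [uIcc_of_le zero_le_one]
      exact (continuousOn_ksQ hx0 hx1).mul continuousOn_ksD
    · rw [uIcc_of_le zero_le_one]
      exact continuousOn_ksPrim hx0 hx1
  have hcongr : ∫ t in (0:ℝ)..1, rho4 t / wt t x 1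
      = ∫ t in (0:ℝ)..1, ((ksQ x t * ksD t - ksPrim x t * ksS t) + phiIBP x t) := by
    refine intervalIntegral.integral_congr_uIoo ?_
    intro t ht
    rw [uIoo_of_le zero_le_one] at ht
    simp only
    rw [rho4_div_wt_eq_explicit hx0 hx1 ht.1.le ht.2]
    unfold phiIBP
    ring
  rw [hcongr, intervalIntegral.integral_add hg hΦ]
  -- FTC for `g` with the primitive `G = P·D`
  have hderiv : ∀ t ∈ Ioo (0:ℝ) 1, HasDerivAt (fun t : ℝ => ksPrim x t * ksD t)
      (ksQ x t * ksD t - ksPrim x t * ksS t) t := by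
    intro t ht
    have h := (hasDerivAt_ksPrim hx0 hx1 (by linarith [ht.1]) ht.2.le).mul (hasDerivAt_ksD ht.1 ht.2)
    refine h.congr_deriv ?_
    ring
  have hcont : ContinuousOn (fun t : ℝ => ksPrim x t * ksD t) (Icc 0 1) :=
    (continuousOn_ksPrim hx0 hx1).mul continuousOn_ksD
  rw [integral_eq_sub_of_hasDerivAt_of_le zero_le_one hcont hderiv hg]
  -- endpoint values: D(1) = 0 and P(0,x) = 0
  have hD1 : ksD 1 = 0 := by
    unfold ksD
    have e : ((1:ℝ) + 1) / 2 = 1 := by norm_num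
    simp only [sub_self, zero_div, e, one_pow, reDilog_zero, reDilog_one]
    ring
  have hP0 : ksPrim x 0 = 0 := by
    unfold ksPrim
    simp
  simp only [hD1, hP0, mul_zero, zero_mul, sub_zero, zero_add]

/-- **Set I(c) in the form the certificate integrates**: `setIcRep = ∫₀¹ (1−x)·(∫₀¹ Φ(t,x) dt)² dx`.
[cell result: quad gen 10; certs/SetIbIc (instrument B1′ integrates `Φ`)] -/
theorem setIcRep_eq_integral_phiIBP :
    setIcRep = ∫ x in (0:ℝ)..1, (1 - x) * (∫ t in (0:ℝ)..1, phiIBP x t) ^ 2 := by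
  unfold setIcRep seqInsertion
  refine intervalIntegral.integral_congr_uIoo ?_
  intro x hx
  rw [uIoo_of_le zero_le_one] at hx
  simp only
  rw [integral_rho4_div_wt_eq_integral_phiIBP hx.1 hx.2]

/-- **Set I(b) in the form the certificate integrates**:
`setIbRep = 3∫₀¹ (1−x)·(4/(3x²) − 4/(3x) − 5/9 + (x³ − 6x + 4)/(3x³)·ln(1−x))²·(∫₀¹ Φ(t,x) dt) dx`.
[cell result: quad gen 10; certs/SetIbIc (instrument B1′ integrates `Φ`)] -/
theorem setIbRep_eq_integral_phiIBP :
    setIbRep = 3 * ∫ x in (0:ℝ)..1, (1 - x) *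
      (4 / (3 * x ^ 2) - 4 / (3 * x) - 5 / 9 + (x ^ 3 - 6 * x + 4) / (3 * x ^ 3) * log (1 - x)) ^ 2
        * (∫ t in (0:ℝ)..1, phiIBP x t) := by
  rw [setIbRep_eq]
  congr 1
  refine intervalIntegral.integral_congr_uIoo ?_
  intro x hx
  rw [uIoo_of_le zero_le_one] at hx
  simp only
  rw [integral_rho4_div_wt_eq_integral_phiIBP hx.1 hx.2]

end Summit.Ventures.QEDPrecision.Integrands

end
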